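import Summits.BirchSwinnertonDyer.Rank1Residual.P2.CongruentNumberPairsAtTwoRankOne
import HarnessLib

/-!
# Sub-lane «bsd-p2»: D-CN-5 PILOT FILE 1 — the 17 odd rank-one Monsky-1990 rows of `U_CN` outside the
# LLT family, `BSD(E_n, 2)` from the door with the census datum `L′(E_n,1)/(Ω·Reg) = ∏c_ℓ/16`
# DISPLAYED AS A HYPOTHESIS (p2-lead T-38 / T-41 / T-44: PILOT GO-0, FILE 1)

HONEST FRAMING (sub-lane «bsd-p2», run/shared/lean/b2b/bsd-rank1-residual/p2/, verbatim in every
file): the target of record is the FULL Birch–Swinnerton-Dyer formula for EVERY analytic-rank `≤ 1`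
`E/ℚ` at ALL primes INCLUDING `2`; the odd-prime class ledger is referee A's; the `2`-part is OPEN
(cells O1 = X5 ∖ CM and O12 = the CM corner) and under census by «bsd-p2». Census / instrument
output at `2` = EVIDENCE / conjecture items with held-out validation, NEVER a Literature fact;
certificates close PAIRS (one isogeny class, `p = 2`), never classes. This file asserts NO
arithmetic fact. Each theorem is the door D-CN-5 (`bsdp_two_congruentNumberCurve_iff_of_cor515`,
p320819: Monsky 1990 Cor 5.15 as the ONE named fact `h515`; root number and CM continuation are tree
theorems) instantiated at one `n`, with THREE per-row data DISPLAYED AS HYPOTHESES, none of them proved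
here: `ht` — `#E_n(ℚ)_tor = 4` (lit-2's torsion theorem pending, L2-15); `htam` —
`∏_ℓ c_ℓ(E_n) = 8` (prime rows) or `32` (two-prime rows), the census / Cremona Tamagawa product
(p2-monsky-x `x/doors/FDCN5-JOIN-v1.tsv`@ba2d7005, column `cp`; the tree's local Tamagawa numbers
are abstract, GAP G-T1); `hx` — the rank-one EXACT datum `L′(E_n,1) = (∏c_ℓ/16)·Ω(E_n)·Reg(E_n)`,
i.e. `x = 1/2` resp. `2` (ibid. column `x_identified`, `#Ш_an(E_n) = 1` two-implementation on `E_n`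
itself: census EVIDENCE at certificate tier, DISPLAYED, not a kernel fact). CONCLUSION per row:
`BSD(E_n, 2)` — because `ord₂(∏c/16) = ord₂ ∏c − 4` holds identically, the door's biconditional
fires. What the kernel decides per row: membership `IsCor515Family n` (families (1) `p₇` and (2)
`p₃p₅`, `p₃p₇` of Cor 5.15) and the valuation arithmetic; what stays EVIDENCE: `ht`, `htam`, `hx`.
Rows (n, class): (7, 1568g1), (15, 7200bg1), (21, 14112x1), (23, 16928e1), (31, 30752f1), (39, 48672bt1), (47, 70688c1), (55, 96800bm1), (69, 152352ba1), (71, 161312b1), (77, 189728cn1), (79, 199712f1), (87, 242208z1), (93, 276768w1), (95, 288800bn1), (103, 339488b1), (111, 394272j1). The 9 LLT rows of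
`U_CN` (`n ≡ 5 (mod 8)`) need no `L′`-datum (`P2/CongruentNumberPairsAtTwoLLT.lean`); even rows wait
for census-2's C2-20 (FILE 2). Per-pair statements in the OPEN cell `openO12`; they close no class.
Nothing booked; no mark moved. Unit `b2b-bsdres-p2-typer` GEN 3 (p2-lead T-41 / T-44); NEW file.

References: Monsky, Math. Z. 204 (1990) Cor. 5.15 [Monsky1990MockHeegner]; Miller 2011 Def 1.1 [Miller2011LMS];
HOME/p2/monsky/x/doors/FDCN5-JOIN-v1.tsv; HOME/p2/LEAD-OKS.md T-38, T-41, T-42, T-44.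
-/

noncomputable section

open scoped Classical

open WeierstrassCurve Literature.NumberTheory.EllipticCurves
  Literature.NumberTheory.EllipticCurves.Rank1Residual
  Literature.NumberTheory.EllipticCurves.Rank1Residual.Typed
  Literature.NumberTheory.EllipticCurves.Monsky1990

set_option autoImplicit false

namespace Summit.BirchSwinnertonDyer.Rank1Residual.P2

/-- **The door with the Tamagawa value displayed.** In the setting of
`bsdp_two_congruentNumberCurve_iff_of_cor515`, if moreover `∏c_ℓ(E_N) = c` (`htam`, a displayed
datum) and the exact rank-one value is `x = c/16` (`hx`), then `BSD(E_N, 2)`: the door's valuation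
identity `ord₂ x = ord₂ ∏c_ℓ − 4` holds identically. [cite: Monsky1990MockHeegner, Cor. 5.15 (p. 66)]
[cite: Miller2011LMS, Def. 1.1 (arXiv:1010.2431 p. 3)] -/
theorem bsdp_two_congruentNumberCurve_of_cor515_of_tamagawa
    (h515 : cor515_rank_eq_one_and_card_selmerGroup_two) {N : ℕ} (hN : IsCor515Family N)
    (ht : (congruentNumberCurve N).torsionOrder = 4) {c : ℕ} (hc0 : c ≠ 0)
    (htam : (congruentNumberCurve N).tamagawaProduct = c)
    (hx : deriv (congruentNumberCurve N).entireLFunction 1 =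
      (((c : ℚ) / 16 : ℚ) : ℂ) * ((congruentNumberCurve N).realPeriodRat : ℂ) *
        ((congruentNumberCurve N).regulator : ℂ)) :
    BSDp (congruentNumberCurve N) 2 := by
  haveI : Fact (2 : ℕ).Prime := ⟨Nat.prime_two⟩
  have hx0 : ((c : ℚ) / 16) ≠ 0 := div_ne_zero (by exact_mod_cast hc0) (by norm_num)
  refine (bsdp_two_congruentNumberCurve_iff_of_cor515 h515 hN ht hx0 hx).2.mpr ?_
  rw [htam, padicValRat.div (by exact_mod_cast hc0) (by norm_num), padicValRat.of_nat]
  have h16 : padicValRat 2 (16 : ℚ) = 4 := by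
    rw [show (16 : ℚ) = ((2 ^ 4 : ℕ) : ℚ) by norm_num, padicValRat.of_nat, padicValNat.prime_pow]
    norm_num
  rw [h16]

/-- **`BSD(E_{7}, 2)`** (`y² = x³ − 7²x`, class `1568g1`, `N = 1568`, rank `1`, cell `openO12`) from
the door D-CN-5, with the row's data DISPLAYED: `#tor = 4` (`ht`), `∏c_ℓ = 8` (`htam`, Cremona /
census), `L′(E_{7},1) = (1/2)·Ω·Reg` (`hx`, x's FDCN5-JOIN-v1 `x_identified = 1/2`, EVIDENCE).
[cite: Monsky1990MockHeegner, Cor. 5.15 (p. 66)] [cite: Miller2011LMS, Def. 1.1] -/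
theorem bsdp_two_congruentNumberCurve_7 (h515 : cor515_rank_eq_one_and_card_selmerGroup_two)
    (ht : (congruentNumberCurve 7).torsionOrder = 4)
    (htam : (congruentNumberCurve 7).tamagawaProduct = 8)
    (hx : deriv (congruentNumberCurve 7).entireLFunction 1 =
      (((8 : ℕ) : ℚ) / 16 : ℚ) * ((congruentNumberCurve 7).realPeriodRat : ℂ) *
        ((congruentNumberCurve 7).regulator : ℂ)) :
    BSDp (congruentNumberCurve 7) 2 :=
  bsdp_two_congruentNumberCurve_of_cor515_of_tamagawa h515 isCor515Family_seven ht (by norm_num) htam hx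

/-- **`BSD(E_{15}, 2)`** (`y² = x³ − 15²x`, class `7200bg1`, `N = 7200`, rank `1`, cell `openO12`) from
the door D-CN-5, with the row's data DISPLAYED: `#tor = 4` (`ht`), `∏c_ℓ = 32` (`htam`, Cremona /
census), `L′(E_{15},1) = (2)·Ω·Reg` (`hx`, x's FDCN5-JOIN-v1 `x_identified = 2`, EVIDENCE).
[cite: Monsky1990MockHeegner, Cor. 5.15 (p. 66)] [cite: Miller2011LMS, Def. 1.1] -/
theorem bsdp_two_congruentNumberCurve_15 (h515 : cor515_rank_eq_one_and_card_selmerGroup_two)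
    (ht : (congruentNumberCurve 15).torsionOrder = 4)
    (htam : (congruentNumberCurve 15).tamagawaProduct = 32)
    (hx : deriv (congruentNumberCurve 15).entireLFunction 1 =
      (((32 : ℕ) : ℚ) / 16 : ℚ) * ((congruentNumberCurve 15).realPeriodRat : ℂ) *
        ((congruentNumberCurve 15).regulator : ℂ)) :
    BSDp (congruentNumberCurve 15) 2 :=
  bsdp_two_congruentNumberCurve_of_cor515_of_tamagawa h515 isCor515Family_fifteen ht (by norm_num) htam hx

/-- **`BSD(E_{21}, 2)`** (`y² = x³ − 21²x`, class `14112x1`, `N = 14112`, rank `1`, cell `openO12`) from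
the door D-CN-5, with the row's data DISPLAYED: `#tor = 4` (`ht`), `∏c_ℓ = 32` (`htam`, Cremona /
census), `L′(E_{21},1) = (2)·Ω·Reg` (`hx`, x's FDCN5-JOIN-v1 `x_identified = 2`, EVIDENCE).
[cite: Monsky1990MockHeegner, Cor. 5.15 (p. 66)] [cite: Miller2011LMS, Def. 1.1] -/
theorem bsdp_two_congruentNumberCurve_21 (h515 : cor515_rank_eq_one_and_card_selmerGroup_two)
    (ht : (congruentNumberCurve 21).torsionOrder = 4)
    (htam : (congruentNumberCurve 21).tamagawaProduct = 32)
    (hx : deriv (congruentNumberCurve 21).entireLFunction 1 =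
      (((32 : ℕ) : ℚ) / 16 : ℚ) * ((congruentNumberCurve 21).realPeriodRat : ℂ) *
        ((congruentNumberCurve 21).regulator : ℂ)) :
    BSDp (congruentNumberCurve 21) 2 :=
  bsdp_two_congruentNumberCurve_of_cor515_of_tamagawa h515 isCor515Family_twentyone ht (by norm_num) htam hx

/-- `23 = p₇` (prime `≡ 7 (mod 8)`; group (1) of Cor. 5.15). [cite: Monsky1990MockHeegner, Cor. 5.15 (p. 66)] -/
theorem isCor515Family_23 : IsCor515Family 23 :=
  Or.inl ⟨by norm_num, by norm_num⟩

/-- **`BSD(E_{23}, 2)`** (`y² = x³ − 23²x`, class `16928e1`, `N = 16928`, rank `1`, cell `openO12`) from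
the door D-CN-5, with the row's data DISPLAYED: `#tor = 4` (`ht`), `∏c_ℓ = 8` (`htam`, Cremona /
census), `L′(E_{23},1) = (1/2)·Ω·Reg` (`hx`, x's FDCN5-JOIN-v1 `x_identified = 1/2`, EVIDENCE).
[cite: Monsky1990MockHeegner, Cor. 5.15 (p. 66)] [cite: Miller2011LMS, Def. 1.1] -/
theorem bsdp_two_congruentNumberCurve_23 (h515 : cor515_rank_eq_one_and_card_selmerGroup_two)
    (ht : (congruentNumberCurve 23).torsionOrder = 4)
    (htam : (congruentNumberCurve 23).tamagawaProduct = 8)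
    (hx : deriv (congruentNumberCurve 23).entireLFunction 1 =
      (((8 : ℕ) : ℚ) / 16 : ℚ) * ((congruentNumberCurve 23).realPeriodRat : ℂ) *
        ((congruentNumberCurve 23).regulator : ℂ)) :
    BSDp (congruentNumberCurve 23) 2 :=
  bsdp_two_congruentNumberCurve_of_cor515_of_tamagawa h515 isCor515Family_23 ht (by norm_num) htam hx

/-- `31 = p₇` (prime `≡ 7 (mod 8)`; group (1) of Cor. 5.15). [cite: Monsky1990MockHeegner, Cor. 5.15 (p. 66)] -/
theorem isCor515Family_31 : IsCor515Family 31 :=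
  Or.inl ⟨by norm_num, by norm_num⟩

/-- **`BSD(E_{31}, 2)`** (`y² = x³ − 31²x`, class `30752f1`, `N = 30752`, rank `1`, cell `openO12`) from
the door D-CN-5, with the row's data DISPLAYED: `#tor = 4` (`ht`), `∏c_ℓ = 8` (`htam`, Cremona /
census), `L′(E_{31},1) = (1/2)·Ω·Reg` (`hx`, x's FDCN5-JOIN-v1 `x_identified = 1/2`, EVIDENCE).
[cite: Monsky1990MockHeegner, Cor. 5.15 (p. 66)] [cite: Miller2011LMS, Def. 1.1] -/
theorem bsdp_two_congruentNumberCurve_31 (h515 : cor515_rank_eq_one_and_card_selmerGroup_two)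
    (ht : (congruentNumberCurve 31).torsionOrder = 4)
    (htam : (congruentNumberCurve 31).tamagawaProduct = 8)
    (hx : deriv (congruentNumberCurve 31).entireLFunction 1 =
      (((8 : ℕ) : ℚ) / 16 : ℚ) * ((congruentNumberCurve 31).realPeriodRat : ℂ) *
        ((congruentNumberCurve 31).regulator : ℂ)) :
    BSDp (congruentNumberCurve 31) 2 :=
  bsdp_two_congruentNumberCurve_of_cor515_of_tamagawa h515 isCor515Family_31 ht (by norm_num) htam hx

/-- `39 = 3·13 = p₃·p_5` (group (2) of Cor. 5.15). [cite: Monsky1990MockHeegner, Cor. 5.15 (p. 66)] -/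
theorem isCor515Family_39 : IsCor515Family 39 :=
  Or.inr (Or.inr (Or.inl ⟨3, 13, by norm_num, by norm_num, by norm_num, by norm_num, rfl⟩))

/-- **`BSD(E_{39}, 2)`** (`y² = x³ − 39²x`, class `48672bt1`, `N = 48672`, rank `1`, cell `openO12`) from
the door D-CN-5, with the row's data DISPLAYED: `#tor = 4` (`ht`), `∏c_ℓ = 32` (`htam`, Cremona /
census), `L′(E_{39},1) = (2)·Ω·Reg` (`hx`, x's FDCN5-JOIN-v1 `x_identified = 2`, EVIDENCE).
[cite: Monsky1990MockHeegner, Cor. 5.15 (p. 66)] [cite: Miller2011LMS, Def. 1.1] -/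
theorem bsdp_two_congruentNumberCurve_39 (h515 : cor515_rank_eq_one_and_card_selmerGroup_two)
    (ht : (congruentNumberCurve 39).torsionOrder = 4)
    (htam : (congruentNumberCurve 39).tamagawaProduct = 32)
    (hx : deriv (congruentNumberCurve 39).entireLFunction 1 =
      (((32 : ℕ) : ℚ) / 16 : ℚ) * ((congruentNumberCurve 39).realPeriodRat : ℂ) *
        ((congruentNumberCurve 39).regulator : ℂ)) :
    BSDp (congruentNumberCurve 39) 2 :=
  bsdp_two_congruentNumberCurve_of_cor515_of_tamagawa h515 isCor515Family_39 ht (by norm_num) htam hx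

/-- `47 = p₇` (prime `≡ 7 (mod 8)`; group (1) of Cor. 5.15). [cite: Monsky1990MockHeegner, Cor. 5.15 (p. 66)] -/
theorem isCor515Family_47 : IsCor515Family 47 :=
  Or.inl ⟨by norm_num, by norm_num⟩

/-- **`BSD(E_{47}, 2)`** (`y² = x³ − 47²x`, class `70688c1`, `N = 70688`, rank `1`, cell `openO12`) from
the door D-CN-5, with the row's data DISPLAYED: `#tor = 4` (`ht`), `∏c_ℓ = 8` (`htam`, Cremona /
census), `L′(E_{47},1) = (1/2)·Ω·Reg` (`hx`, x's FDCN5-JOIN-v1 `x_identified = 1/2`, EVIDENCE).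
[cite: Monsky1990MockHeegner, Cor. 5.15 (p. 66)] [cite: Miller2011LMS, Def. 1.1] -/
theorem bsdp_two_congruentNumberCurve_47 (h515 : cor515_rank_eq_one_and_card_selmerGroup_two)
    (ht : (congruentNumberCurve 47).torsionOrder = 4)
    (htam : (congruentNumberCurve 47).tamagawaProduct = 8)
    (hx : deriv (congruentNumberCurve 47).entireLFunction 1 =
      (((8 : ℕ) : ℚ) / 16 : ℚ) * ((congruentNumberCurve 47).realPeriodRat : ℂ) *
        ((congruentNumberCurve 47).regulator : ℂ)) :
    BSDp (congruentNumberCurve 47) 2 :=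
  bsdp_two_congruentNumberCurve_of_cor515_of_tamagawa h515 isCor515Family_47 ht (by norm_num) htam hx

/-- `55 = 11·5 = p₃·p_5` (group (2) of Cor. 5.15). [cite: Monsky1990MockHeegner, Cor. 5.15 (p. 66)] -/
theorem isCor515Family_55 : IsCor515Family 55 :=
  Or.inr (Or.inr (Or.inl ⟨11, 5, by norm_num, by norm_num, by norm_num, by norm_num, by norm_num⟩))

/-- **`BSD(E_{55}, 2)`** (`y² = x³ − 55²x`, class `96800bm1`, `N = 96800`, rank `1`, cell `openO12`) from
the door D-CN-5, with the row's data DISPLAYED: `#tor = 4` (`ht`), `∏c_ℓ = 32` (`htam`, Cremona /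
census), `L′(E_{55},1) = (2)·Ω·Reg` (`hx`, x's FDCN5-JOIN-v1 `x_identified = 2`, EVIDENCE).
[cite: Monsky1990MockHeegner, Cor. 5.15 (p. 66)] [cite: Miller2011LMS, Def. 1.1] -/
theorem bsdp_two_congruentNumberCurve_55 (h515 : cor515_rank_eq_one_and_card_selmerGroup_two)
    (ht : (congruentNumberCurve 55).torsionOrder = 4)
    (htam : (congruentNumberCurve 55).tamagawaProduct = 32)
    (hx : deriv (congruentNumberCurve 55).entireLFunction 1 =
      (((32 : ℕ) : ℚ) / 16 : ℚ) * ((congruentNumberCurve 55).realPeriodRat : ℂ) *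
        ((congruentNumberCurve 55).regulator : ℂ)) :
    BSDp (congruentNumberCurve 55) 2 :=
  bsdp_two_congruentNumberCurve_of_cor515_of_tamagawa h515 isCor515Family_55 ht (by norm_num) htam hx

/-- `69 = 3·23 = p₃·p_7` (group (2) of Cor. 5.15). [cite: Monsky1990MockHeegner, Cor. 5.15 (p. 66)] -/
theorem isCor515Family_69 : IsCor515Family 69 :=
  Or.inr (Or.inr (Or.inl ⟨3, 23, by norm_num, by norm_num, by norm_num, by norm_num, rfl⟩))

/-- **`BSD(E_{69}, 2)`** (`y² = x³ − 69²x`, class `152352ba1`, `N = 152352`, rank `1`, cell `openO12`) from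
the door D-CN-5, with the row's data DISPLAYED: `#tor = 4` (`ht`), `∏c_ℓ = 32` (`htam`, Cremona /
census), `L′(E_{69},1) = (2)·Ω·Reg` (`hx`, x's FDCN5-JOIN-v1 `x_identified = 2`, EVIDENCE).
[cite: Monsky1990MockHeegner, Cor. 5.15 (p. 66)] [cite: Miller2011LMS, Def. 1.1] -/
theorem bsdp_two_congruentNumberCurve_69 (h515 : cor515_rank_eq_one_and_card_selmerGroup_two)
    (ht : (congruentNumberCurve 69).torsionOrder = 4)
    (htam : (congruentNumberCurve 69).tamagawaProduct = 32)
    (hx : deriv (congruentNumberCurve 69).entireLFunction 1 =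
      (((32 : ℕ) : ℚ) / 16 : ℚ) * ((congruentNumberCurve 69).realPeriodRat : ℂ) *
        ((congruentNumberCurve 69).regulator : ℂ)) :
    BSDp (congruentNumberCurve 69) 2 :=
  bsdp_two_congruentNumberCurve_of_cor515_of_tamagawa h515 isCor515Family_69 ht (by norm_num) htam hx

/-- `71 = p₇` (prime `≡ 7 (mod 8)`; group (1) of Cor. 5.15). [cite: Monsky1990MockHeegner, Cor. 5.15 (p. 66)] -/
theorem isCor515Family_71 : IsCor515Family 71 :=
  Or.inl ⟨by norm_num, by norm_num⟩

/-- **`BSD(E_{71}, 2)`** (`y² = x³ − 71²x`, class `161312b1`, `N = 161312`, rank `1`, cell `openO12`) from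
the door D-CN-5, with the row's data DISPLAYED: `#tor = 4` (`ht`), `∏c_ℓ = 8` (`htam`, Cremona /
census), `L′(E_{71},1) = (1/2)·Ω·Reg` (`hx`, x's FDCN5-JOIN-v1 `x_identified = 1/2`, EVIDENCE).
[cite: Monsky1990MockHeegner, Cor. 5.15 (p. 66)] [cite: Miller2011LMS, Def. 1.1] -/
theorem bsdp_two_congruentNumberCurve_71 (h515 : cor515_rank_eq_one_and_card_selmerGroup_two)
    (ht : (congruentNumberCurve 71).torsionOrder = 4)
    (htam : (congruentNumberCurve 71).tamagawaProduct = 8)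
    (hx : deriv (congruentNumberCurve 71).entireLFunction 1 =
      (((8 : ℕ) : ℚ) / 16 : ℚ) * ((congruentNumberCurve 71).realPeriodRat : ℂ) *
        ((congruentNumberCurve 71).regulator : ℂ)) :
    BSDp (congruentNumberCurve 71) 2 :=
  bsdp_two_congruentNumberCurve_of_cor515_of_tamagawa h515 isCor515Family_71 ht (by norm_num) htam hx

/-- `77 = 11·7 = p₃·p_7` (group (2) of Cor. 5.15). [cite: Monsky1990MockHeegner, Cor. 5.15 (p. 66)] -/
theorem isCor515Family_77 : IsCor515Family 77 :=
  Or.inr (Or.inr (Or.inl ⟨11, 7, by norm_num, by norm_num, by norm_num, by norm_num, by norm_num⟩))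

/-- **`BSD(E_{77}, 2)`** (`y² = x³ − 77²x`, class `189728cn1`, `N = 189728`, rank `1`, cell `openO12`) from
the door D-CN-5, with the row's data DISPLAYED: `#tor = 4` (`ht`), `∏c_ℓ = 32` (`htam`, Cremona /
census), `L′(E_{77},1) = (2)·Ω·Reg` (`hx`, x's FDCN5-JOIN-v1 `x_identified = 2`, EVIDENCE).
[cite: Monsky1990MockHeegner, Cor. 5.15 (p. 66)] [cite: Miller2011LMS, Def. 1.1] -/
theorem bsdp_two_congruentNumberCurve_77 (h515 : cor515_rank_eq_one_and_card_selmerGroup_two)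
    (ht : (congruentNumberCurve 77).torsionOrder = 4)
    (htam : (congruentNumberCurve 77).tamagawaProduct = 32)
    (hx : deriv (congruentNumberCurve 77).entireLFunction 1 =
      (((32 : ℕ) : ℚ) / 16 : ℚ) * ((congruentNumberCurve 77).realPeriodRat : ℂ) *
        ((congruentNumberCurve 77).regulator : ℂ)) :
    BSDp (congruentNumberCurve 77) 2 :=
  bsdp_two_congruentNumberCurve_of_cor515_of_tamagawa h515 isCor515Family_77 ht (by norm_num) htam hx

/-- `79 = p₇` (prime `≡ 7 (mod 8)`; group (1) of Cor. 5.15). [cite: Monsky1990MockHeegner, Cor. 5.15 (p. 66)] -/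
theorem isCor515Family_79 : IsCor515Family 79 :=
  Or.inl ⟨by norm_num, by norm_num⟩

/-- **`BSD(E_{79}, 2)`** (`y² = x³ − 79²x`, class `199712f1`, `N = 199712`, rank `1`, cell `openO12`) from
the door D-CN-5, with the row's data DISPLAYED: `#tor = 4` (`ht`), `∏c_ℓ = 8` (`htam`, Cremona /
census), `L′(E_{79},1) = (1/2)·Ω·Reg` (`hx`, x's FDCN5-JOIN-v1 `x_identified = 1/2`, EVIDENCE).
[cite: Monsky1990MockHeegner, Cor. 5.15 (p. 66)] [cite: Miller2011LMS, Def. 1.1] -/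
theorem bsdp_two_congruentNumberCurve_79 (h515 : cor515_rank_eq_one_and_card_selmerGroup_two)
    (ht : (congruentNumberCurve 79).torsionOrder = 4)
    (htam : (congruentNumberCurve 79).tamagawaProduct = 8)
    (hx : deriv (congruentNumberCurve 79).entireLFunction 1 =
      (((8 : ℕ) : ℚ) / 16 : ℚ) * ((congruentNumberCurve 79).realPeriodRat : ℂ) *
        ((congruentNumberCurve 79).regulator : ℂ)) :
    BSDp (congruentNumberCurve 79) 2 :=
  bsdp_two_congruentNumberCurve_of_cor515_of_tamagawa h515 isCor515Family_79 ht (by norm_num) htam hx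

/-- `87 = 3·29 = p₃·p_5` (group (2) of Cor. 5.15). [cite: Monsky1990MockHeegner, Cor. 5.15 (p. 66)] -/
theorem isCor515Family_87 : IsCor515Family 87 :=
  Or.inr (Or.inr (Or.inl ⟨3, 29, by norm_num, by norm_num, by norm_num, by norm_num, rfl⟩))

/-- **`BSD(E_{87}, 2)`** (`y² = x³ − 87²x`, class `242208z1`, `N = 242208`, rank `1`, cell `openO12`) from
the door D-CN-5, with the row's data DISPLAYED: `#tor = 4` (`ht`), `∏c_ℓ = 32` (`htam`, Cremona /
census), `L′(E_{87},1) = (2)·Ω·Reg` (`hx`, x's FDCN5-JOIN-v1 `x_identified = 2`, EVIDENCE).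
[cite: Monsky1990MockHeegner, Cor. 5.15 (p. 66)] [cite: Miller2011LMS, Def. 1.1] -/
theorem bsdp_two_congruentNumberCurve_87 (h515 : cor515_rank_eq_one_and_card_selmerGroup_two)
    (ht : (congruentNumberCurve 87).torsionOrder = 4)
    (htam : (congruentNumberCurve 87).tamagawaProduct = 32)
    (hx : deriv (congruentNumberCurve 87).entireLFunction 1 =
      (((32 : ℕ) : ℚ) / 16 : ℚ) * ((congruentNumberCurve 87).realPeriodRat : ℂ) *
        ((congruentNumberCurve 87).regulator : ℂ)) :
    BSDp (congruentNumberCurve 87) 2 :=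
  bsdp_two_congruentNumberCurve_of_cor515_of_tamagawa h515 isCor515Family_87 ht (by norm_num) htam hx

/-- `93 = 3·31 = p₃·p_7` (group (2) of Cor. 5.15). [cite: Monsky1990MockHeegner, Cor. 5.15 (p. 66)] -/
theorem isCor515Family_93 : IsCor515Family 93 :=
  Or.inr (Or.inr (Or.inl ⟨3, 31, by norm_num, by norm_num, by norm_num, by norm_num, rfl⟩))

/-- **`BSD(E_{93}, 2)`** (`y² = x³ − 93²x`, class `276768w1`, `N = 276768`, rank `1`, cell `openO12`) from
the door D-CN-5, with the row's data DISPLAYED: `#tor = 4` (`ht`), `∏c_ℓ = 32` (`htam`, Cremona /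
census), `L′(E_{93},1) = (2)·Ω·Reg` (`hx`, x's FDCN5-JOIN-v1 `x_identified = 2`, EVIDENCE).
[cite: Monsky1990MockHeegner, Cor. 5.15 (p. 66)] [cite: Miller2011LMS, Def. 1.1] -/
theorem bsdp_two_congruentNumberCurve_93 (h515 : cor515_rank_eq_one_and_card_selmerGroup_two)
    (ht : (congruentNumberCurve 93).torsionOrder = 4)
    (htam : (congruentNumberCurve 93).tamagawaProduct = 32)
    (hx : deriv (congruentNumberCurve 93).entireLFunction 1 =
      (((32 : ℕ) : ℚ) / 16 : ℚ) * ((congruentNumberCurve 93).realPeriodRat : ℂ) *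
        ((congruentNumberCurve 93).regulator : ℂ)) :
    BSDp (congruentNumberCurve 93) 2 :=
  bsdp_two_congruentNumberCurve_of_cor515_of_tamagawa h515 isCor515Family_93 ht (by norm_num) htam hx

/-- `95 = 19·5 = p₃·p_5` (group (2) of Cor. 5.15). [cite: Monsky1990MockHeegner, Cor. 5.15 (p. 66)] -/
theorem isCor515Family_95 : IsCor515Family 95 :=
  Or.inr (Or.inr (Or.inl ⟨19, 5, by norm_num, by norm_num, by norm_num, by norm_num, by norm_num⟩))

/-- **`BSD(E_{95}, 2)`** (`y² = x³ − 95²x`, class `288800bn1`, `N = 288800`, rank `1`, cell `openO12`) from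
the door D-CN-5, with the row's data DISPLAYED: `#tor = 4` (`ht`), `∏c_ℓ = 32` (`htam`, Cremona /
census), `L′(E_{95},1) = (2)·Ω·Reg` (`hx`, x's FDCN5-JOIN-v1 `x_identified = 2`, EVIDENCE).
[cite: Monsky1990MockHeegner, Cor. 5.15 (p. 66)] [cite: Miller2011LMS, Def. 1.1] -/
theorem bsdp_two_congruentNumberCurve_95 (h515 : cor515_rank_eq_one_and_card_selmerGroup_two)
    (ht : (congruentNumberCurve 95).torsionOrder = 4)
    (htam : (congruentNumberCurve 95).tamagawaProduct = 32)
    (hx : deriv (congruentNumberCurve 95).entireLFunction 1 =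
      (((32 : ℕ) : ℚ) / 16 : ℚ) * ((congruentNumberCurve 95).realPeriodRat : ℂ) *
        ((congruentNumberCurve 95).regulator : ℂ)) :
    BSDp (congruentNumberCurve 95) 2 :=
  bsdp_two_congruentNumberCurve_of_cor515_of_tamagawa h515 isCor515Family_95 ht (by norm_num) htam hx

/-- `103 = p₇` (prime `≡ 7 (mod 8)`; group (1) of Cor. 5.15). [cite: Monsky1990MockHeegner, Cor. 5.15 (p. 66)] -/
theorem isCor515Family_103 : IsCor515Family 103 :=
  Or.inl ⟨by norm_num, by norm_num⟩

/-- **`BSD(E_{103}, 2)`** (`y² = x³ − 103²x`, class `339488b1`, `N = 339488`, rank `1`, cell `openO12`) from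
the door D-CN-5, with the row's data DISPLAYED: `#tor = 4` (`ht`), `∏c_ℓ = 8` (`htam`, Cremona /
census), `L′(E_{103},1) = (1/2)·Ω·Reg` (`hx`, x's FDCN5-JOIN-v1 `x_identified = 1/2`, EVIDENCE).
[cite: Monsky1990MockHeegner, Cor. 5.15 (p. 66)] [cite: Miller2011LMS, Def. 1.1] -/
theorem bsdp_two_congruentNumberCurve_103 (h515 : cor515_rank_eq_one_and_card_selmerGroup_two)
    (ht : (congruentNumberCurve 103).torsionOrder = 4)
    (htam : (congruentNumberCurve 103).tamagawaProduct = 8)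
    (hx : deriv (congruentNumberCurve 103).entireLFunction 1 =
      (((8 : ℕ) : ℚ) / 16 : ℚ) * ((congruentNumberCurve 103).realPeriodRat : ℂ) *
        ((congruentNumberCurve 103).regulator : ℂ)) :
    BSDp (congruentNumberCurve 103) 2 :=
  bsdp_two_congruentNumberCurve_of_cor515_of_tamagawa h515 isCor515Family_103 ht (by norm_num) htam hx

/-- `111 = 3·37 = p₃·p_5` (group (2) of Cor. 5.15). [cite: Monsky1990MockHeegner, Cor. 5.15 (p. 66)] -/
theorem isCor515Family_111 : IsCor515Family 111 :=
  Or.inr (Or.inr (Or.inl ⟨3, 37, by norm_num, by norm_num, by norm_num, by norm_num, rfl⟩))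

/-- **`BSD(E_{111}, 2)`** (`y² = x³ − 111²x`, class `394272j1`, `N = 394272`, rank `1`, cell `openO12`) from
the door D-CN-5, with the row's data DISPLAYED: `#tor = 4` (`ht`), `∏c_ℓ = 32` (`htam`, Cremona /
census), `L′(E_{111},1) = (2)·Ω·Reg` (`hx`, x's FDCN5-JOIN-v1 `x_identified = 2`, EVIDENCE).
[cite: Monsky1990MockHeegner, Cor. 5.15 (p. 66)] [cite: Miller2011LMS, Def. 1.1] -/
theorem bsdp_two_congruentNumberCurve_111 (h515 : cor515_rank_eq_one_and_card_selmerGroup_two)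
    (ht : (congruentNumberCurve 111).torsionOrder = 4)
    (htam : (congruentNumberCurve 111).tamagawaProduct = 32)
    (hx : deriv (congruentNumberCurve 111).entireLFunction 1 =
      (((32 : ℕ) : ℚ) / 16 : ℚ) * ((congruentNumberCurve 111).realPeriodRat : ℂ) *
        ((congruentNumberCurve 111).regulator : ℂ)) :
    BSDp (congruentNumberCurve 111) 2 :=
  bsdp_two_congruentNumberCurve_of_cor515_of_tamagawa h515 isCor515Family_111 ht (by norm_num) htam hx

end Summit.BirchSwinnertonDyer.Rank1Residual.P2

end
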